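import Mathlib
import Literature.NumberTheory.LFunctions.Zhang2022.SkeletonPartTwo
import Literature.NumberTheory.LFunctions.Zhang2022.SkeletonAssembly
import Literature.NumberTheory.LFunctions.Zhang2022.SkeletonReductions
import Literature.NumberTheory.LFunctions.Zhang2022.TypedSection11B
import HarnessLib

/-!
# Zhang (2022) §11 p. 65: the `E₂` mean square `ΣΣ𝔠*E₂(ρ,ψ)²ω(ρ) = o(𝔞𝔓)` reduced to Lemma 8.1,
# Proposition 7.1 and a polylogarithmic bound for `S_j`

Topic `Literature/NumberTheory/LFunctions/Zhang2022` (Landau–Siegel audit tree; verdict-neutral).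
Y. Zhang, *Discrete mean estimates and the Landau–Siegel zero*, arXiv:2211.02515v1 (2022)
[Zhang2022LandauSiegel], §11 p. 65 (tex L3348–L3352): "By Lemma 11.2, the proof of (11.6) is
reduced to showing that `Σ_{ψ∈Ψ₁}Σ_{ρ∈𝔷(ψ)} 𝔠*(ρ,ψ)E₂(ρ,ψ)²ω(ρ) = o(𝔞𝔓)`. This follows by (8.25),
(8.26) and simple estimates." — **an unrefereed manuscript under adjudication; nothing here asserts
or denies its Theorems 1–2.** The displays "(8.25), (8.26)" do not exist in v1 (§8 ends at (8.24));
the cell (`siegel-zhang`, DAG node `Z22:§11.u027`, typed CLAIM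
`Typed.TypedSection11B.Step11u027`, GAP candidate G·11c) reads them as the discrete mean-value
estimate that Lemma 8.1 + Proposition 7.1 provide. This file makes that reading a kernel
implication in two steps (antecedents written inline; discharge seat d36):

* `dmv_of_lemma81_prop71` — Lemma 8.1 and Prop. 7.1 at the admissible pair
  `𝐚 = (χ(n)n^{−iv}1_{n<P₁})_n`, `ā`, together with a bound `|S_j(𝐚₁,𝐚₂)| ≤ K𝓛^B` for all
  sequences admissible for (7.2) with `|a(n)| ≤ 1`, give the DISCRETE MEAN VALUE bound
  `ΣΣ𝔠*(ρ,ψ)|Σ_{n<P₁}χψ(n)n^{−(ρ+iv)}|²ω(ρ) ≤ K′𝓛^{B+9}𝔓`, uniformly in `v ∈ ℝ` (on the critical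
  line `A(ā;1−ρ,ψ̄) = conj A(𝐚;ρ,ψ)`, so the left side of Lemma 8.1 is this mean square; the main
  term of Prop. 7.1 is `α⁻¹(½S₁+2S₂+3/2S₃)𝔓`, `α⁻¹ = 𝓛⁹/π`);
* `step11u027_of_dmv` — such a mean-value bound with any exponent `A ≤ 95` gives `Step11u027`:
  `E₂(ρ,ψ)² ≤ 𝓛⁻¹³⁶·2𝓛²⁰∫_{−𝓛²⁰}^{𝓛²⁰}|Σ_{n<P₁}χψ(n)n^{−(ρ+iv)}|²dv` (Cauchy–Schwarz in `v`,
  `0 < ω₁(iv) ≤ 1`), so `ΣΣ𝔠*E₂²ω ≤ 4K𝓛^{A−96}𝔓 = o(𝔞𝔓)` (`𝔞 ≫ 1`);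
* `step11u027_of_sjPolylog` — the composition (`B ≤ 86`).

Silent inputs made explicit: Lemma 2.3 and Prop. 2.2 (i) (real non-negative weights `𝔠*ω` at
the zeros, which lie on `σ = 1/2`), `𝔞 ≫ 1`. 0 new facts; standard axioms.

## References

* Y. Zhang, arXiv:2211.02515v1 (2022), §11 p. 65; §7 Prop. 7.1, (7.2); §8 Lemma 8.1.
  [cite: Zhang2022LandauSiegel, §11 p. 65]
-/

noncomputable section

open Complex Real ComplexConjugate MeasureTheory

namespace Literature.NumberTheory.LFunctions.Zhang2022.Section11E2MeanSquare

open Literature.NumberTheory.LFunctions.Zhang2022.Skeleton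
open Literature.NumberTheory.LFunctions.Zhang2022.Typed.TypedSection11B

/-! ### Elementary lemmas -/

/-- `log D ≥ 2` once `D ≥ 8`. [folklore] -/
private theorem two_le_log_of_eight_le {D : ℕ} (hD : 8 ≤ D) : 2 ≤ Real.log D := by
  have h8 : (8 : ℝ) ≤ D := by exact_mod_cast hD
  have h2 : (2 : ℝ) ≤ Real.log 8 := by
    rw [Real.le_log_iff_exp_le (by norm_num)]
    have h1 := Real.exp_one_lt_d9
    have h0 := Real.exp_pos 1
    have hsq : Real.exp 2 = Real.exp 1 * Real.exp 1 := by rw [← Real.exp_add]; norm_num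
    rw [hsq]
    nlinarith
  exact h2.trans (Real.log_le_log (by norm_num) h8)

/-- `conj (n^m) = n^{conj m}` for a natural number `n`. [folklore] -/
private theorem conj_natCast_cpow (n : ℕ) (m : ℂ) : conj ((n : ℂ) ^ m) = (n : ℂ) ^ conj m := by
  have h := Complex.conj_cpow (n : ℂ) (conj m) (by rw [Complex.natCast_arg]; exact Real.pi_pos.ne)
  rw [Complex.conj_natCast, Complex.conj_conj] at h
  exact h.symm

/-- On the critical line `conj ρ = 1 − ρ`. [folklore] -/
private theorem conj_eq_one_sub {ρ : ℂ} (hρ : ρ.re = 1 / 2) : conj ρ = 1 - ρ := by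
  apply Complex.ext
  · simp [hρ]; norm_num
  · simp

/-- **Cauchy–Schwarz on an interval**: `(∫_a^b f)² ≤ (b − a)∫_a^b f²` for `f` continuous, `a ≤ b`.
[folklore] -/
private theorem sq_integral_le {f : ℝ → ℝ} {a b : ℝ} (hab : a ≤ b) (hf : Continuous f) :
    (∫ v in a..b, f v) ^ 2 ≤ (b - a) * ∫ v in a..b, f v ^ 2 := by
  rcases eq_or_lt_of_le hab with rfl | hlt
  · simp
  have hba : 0 < b - a := sub_pos.mpr hlt
  set X : ℝ := ∫ v in a..b, f v with hX
  set m : ℝ := X / (b - a) with hm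
  have hfi : IntervalIntegrable f volume a b := hf.intervalIntegrable a b
  have hf2i : IntervalIntegrable (fun v => f v ^ 2) volume a b := (hf.pow 2).intervalIntegrable a b
  have h0 : 0 ≤ ∫ v in a..b, (f v - m) ^ 2 :=
    intervalIntegral.integral_nonneg hab fun v _ => sq_nonneg _
  have hexp : ∫ v in a..b, (f v - m) ^ 2 =
      (∫ v in a..b, f v ^ 2) - 2 * m * X + m ^ 2 * (b - a) := by
    have e : (fun v => (f v - m) ^ 2) = fun v => f v ^ 2 - (2 * m) * f v + m ^ 2 := by
      funext v; ring
    rw [e, intervalIntegral.integral_add (hf2i.sub (hfi.const_mul _)) intervalIntegrable_const,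
      intervalIntegral.integral_sub hf2i (hfi.const_mul _), intervalIntegral.integral_const_mul,
      intervalIntegral.integral_const, smul_eq_mul]
    ring
  rw [hexp, hm] at h0
  have key : X ^ 2 / (b - a) ≤ ∫ v in a..b, f v ^ 2 := by
    have : (∫ v in a..b, f v ^ 2) - 2 * (X / (b - a)) * X + (X / (b - a)) ^ 2 * (b - a) =
        (∫ v in a..b, f v ^ 2) - X ^ 2 / (b - a) := by
      field_simp
      ring
    linarith
  rwa [div_le_iff₀ hba, mul_comm] at key

section Main

variable (c' : ℝ) {D : ℕ} [NeZero D] (χ : DirichletCharacter ℂ D) (x : Chr D)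

omit [NeZero D] in
/-- An index of the double sum `ΣΣ` of (2.16) is a pair `(ψ, ρ)` with `ψ ∈ Ψ₁`, `ρ ∈ 𝔷(ψ)`.
[cite: Zhang2022LandauSiegel, §2 (2.16)] -/
private theorem mem_idx {i : (_ : Chr D) × ℂ} (hi : i ∈ idx χ) :
    i.1 ∈ PsiOne χ ∧ i.2 ∈ zeroSet D i.1 := by
  rw [idx, Finset.mem_sigma] at hi
  exact ⟨mem_of_mem_finsetOf hi.1, mem_of_mem_finsetOf hi.2⟩

/-! ### The left side of Lemma 8.1 at `(𝐚, conj 𝐚)` on the critical line is a mean square -/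

omit [NeZero D] in
/-- **`A(ā;1−ρ,ψ̄) = conj A(𝐚;ρ,ψ)`** on the critical line (`ψ̄ = ψ⁻¹`, `conj ρ = 1 − ρ`).
[cite: Zhang2022LandauSiegel, §8 (8.7)–(8.8)] -/
theorem ApolyBar_conj_eq (a : ℕ → ℂ) {ρ : ℂ} (hρ : ρ.re = 1 / 2) :
    ApolyBar x (fun n => conj (a n)) (1 - ρ) = conj (Apoly x a ρ) := by
  rw [ApolyBar, Apoly, Lemma81.dirPoly_def, Lemma81.dirPoly_def, map_sum]
  refine Finset.sum_congr rfl fun n _ => ?_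
  rw [map_mul, map_mul, conj_natCast_cpow, map_neg, conj_eq_one_sub hρ, ← MulChar.star_apply']
  rfl

omit [NeZero D] in
/-- At `(𝐚, conj 𝐚)` and a zero `ρ` on the critical line, the summand of the left side of Lemma 8.1
is `𝔠*(ρ,ψ)|A(𝐚;ρ,ψ)|²ω(ρ)`. [cite: Zhang2022LandauSiegel, §8 Lemma 8.1] -/
theorem lhs81_conj_eq (a : ℕ → ℂ)
    (hre : ∀ i ∈ idx χ, i.2.re = 1 / 2) :
    lhs81 c' χ a (fun n => conj (a n)) =
      ∑ i ∈ idx χ, cstar c' D i.1 i.2 * ((‖Apoly i.1 a i.2‖ ^ 2 : ℝ) : ℂ) * omegaW D i.2 := by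
  rw [lhs81]
  refine Finset.sum_congr rfl fun i hi => ?_
  rw [ApolyBar_conj_eq i.1 a (hre i hi)]
  push_cast
  rw [← Complex.mul_conj']
  ring

/-! ### The sequence `𝐚 = (χ(n)n^{−iv}1_{1 ≤ n < P₁})` -/

omit [NeZero D] in
/-- `|χ(n)n^{−iv}1_{1≤n<P₁}| ≤ 1` and the sequence vanishes from `PT⁻²` on (`P₁ < PT⁻²` for
`log D ≥ 2`): it is admissible for (7.2) with `B = 1`. [cite: Zhang2022LandauSiegel, §7 (7.2)] -/
theorem adm72_twist (hD : 2 ≤ Real.log D) (v : ℝ) :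
    Adm72 D 1 (fun n : ℕ =>
      if 1 ≤ n ∧ (n : ℝ) < Skeleton.P1 D then χ (n : ZMod D) * (n : ℂ) ^ (-(v * I)) else 0) := by
  refine ⟨fun n => ?_, fun n hn => ?_⟩ <;> dsimp only
  · by_cases h : 1 ≤ n ∧ (n : ℝ) < Skeleton.P1 D
    · rw [if_pos h, norm_mul]
      have hn : 0 < n := h.1
      have h1 : ‖(n : ℂ) ^ (-(v * I))‖ = 1 := by
        rw [Complex.norm_natCast_cpow_of_pos hn]; simp
      rw [h1, mul_one]
      exact DirichletCharacter.norm_le_one _ _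
    · rw [if_neg h, norm_zero]; exact zero_le_one
  · rw [if_neg]
    rintro ⟨-, h⟩
    have := P1_lt_P_div_T_sq D hD
    linarith

omit [NeZero D] in
/-- The conjugate sequence is admissible too. [cite: Zhang2022LandauSiegel, §7 (7.2)] -/
theorem adm72_conj {B : ℝ} {a : ℕ → ℂ} (h : Adm72 D B a) : Adm72 D B (fun n => conj (a n)) :=
  ⟨fun n => by
    show ‖conj (a n)‖ ≤ B
    rw [RCLike.norm_conj]; exact h.1 n, fun n hn => by
    show conj (a n) = 0
    rw [h.2 n hn, map_zero]⟩

omit [NeZero D] in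
/-- **`A(𝐚;s,ψ) = Σ_{1≤n<P₁} χψ(n)n^{−(s+iv)}`** for `𝐚 = (χ(n)n^{−iv}1_{1≤n<P₁})` (`log D ≥ 2`, so
that `P₁ ≤ PT⁻²`): the Dirichlet polynomial inside `E₂(s,ψ)`. [cite: Zhang2022LandauSiegel, §11 Lemma 11.2] -/
theorem Apoly_twist (hD : 2 ≤ Real.log D) (v : ℝ) (s : ℂ) :
    Apoly x (fun n : ℕ =>
        if 1 ≤ n ∧ (n : ℝ) < Skeleton.P1 D then χ (n : ZMod D) * (n : ℂ) ^ (-(v * I)) else 0) s =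
      ∑ n ∈ Finset.Ico 1 ⌈Skeleton.P1 D⌉₊, pc χ x n * (n : ℂ) ^ (-(s + v * I)) := by
  have hsub : Finset.Ico 1 ⌈Skeleton.P1 D⌉₊ ⊆ Finset.range (Nsupp D) := by
    intro n hn
    rw [Finset.mem_Ico] at hn
    exact Finset.mem_range.mpr (lt_of_lt_of_le hn.2 (ceil_P1_le_Nsupp D hD))
  rw [Apoly, Lemma81.dirPoly_def, ← Finset.sum_subset hsub]
  · refine Finset.sum_congr rfl fun n hn => ?_
    rw [Finset.mem_Ico] at hn
    have hcond : 1 ≤ n ∧ (n : ℝ) < Skeleton.P1 D := ⟨hn.1, Nat.lt_ceil.mp hn.2⟩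
    have hn0 : (n : ℂ) ≠ 0 := by exact_mod_cast (by omega : n ≠ 0)
    rw [if_pos hcond, pc, show -(s + v * I) = -(v * I) + -s by ring, Complex.cpow_add _ _ hn0]
    ring
  · intro n _ hn
    have h : ¬ (1 ≤ n ∧ (n : ℝ) < Skeleton.P1 D) := by
      rintro ⟨h1, h2⟩
      exact hn (Finset.mem_Ico.mpr ⟨h1, Nat.lt_ceil.mpr h2⟩)
    rw [if_neg h]; ring

/-! ### Step 1: the discrete mean value from Lemma 8.1, Prop. 7.1 and `S_j ≪ 𝓛^B` -/

/-- **Discrete mean value for `Σ_{n<P₁}χψ(n)n^{−(ρ+iv)}` from Lemma 8.1 + Proposition 7.1**: if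
`|S_j(𝐚₁,𝐚₂)| ≤ K𝓛^B` for all sequences admissible for (7.2) with `|a(n)| ≤ 1` (`j = 1,2,3`, `D`
large), then `ΣΣ𝔠*(ρ,ψ)|Σ_{n<P₁}χψ(n)n^{−(ρ+iv)}|²ω(ρ) ≤ K′𝓛^{B+9}𝔓` for every real `v`, under
(A), for `D` large (weights real and non-negative by Lemma 2.3, Prop. 2.2 (i)).
[cite: Zhang2022LandauSiegel, §11 p. 65; §8 Lemma 8.1; §7 Prop. 7.1] -/
theorem dmv_of_lemma81_prop71 {B : ℕ} (h23 : Lemma23 c') (h22 : Prop22i) (h81 : Lemma81 c')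
    (h71 : Prop71 c')
    (hS : ∃ K : ℝ, ForAllLarge fun D _ _ => ∀ j ∈ ({1, 2, 3} : Finset ℕ), ∀ a₁ a₂ : ℕ → ℂ,
      Adm72 D 1 a₁ → Adm72 D 1 a₂ → ‖Sj c' D j a₁ a₂‖ ≤ K * ell D ^ B) :
    ∃ K' : ℝ, ForAllLarge fun D _ χ => AssumptionA D χ → ∀ v : ℝ,
      ∑ i ∈ idx χ, (cstar c' D i.1 i.2).re *
          ‖∑ n ∈ Finset.Ico 1 ⌈Skeleton.P1 D⌉₊, pc χ i.1 n * (n : ℂ) ^ (-(i.2 + v * I))‖ ^ 2 *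
          (omegaW D i.2).re ≤ K' * ell D ^ (B + 9) * frakP D := by
  obtain ⟨K, hS⟩ := hS
  obtain ⟨C, D₁, h71'⟩ := h71 1 1 one_pos
  obtain ⟨D₀, h⟩ := ((h22.and h23).and hS).and (h81 1 1 one_pos)
  refine ⟨2 * ((4 / π) * |K| + 3 * |C| * |K| + 1) + 1, max (max D₀ D₁) 8,
    fun D _ χ hD hq hp hA v => ?_⟩
  have hD8 : 8 ≤ D := le_trans (le_max_right _ _) hD
  have hD3 : 3 ≤ D := le_trans (by norm_num) hD8
  have hlog := two_le_log_of_eight_le hD8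
  have hℓ : 2 ≤ ell D := by rw [ell]; exact hlog
  obtain ⟨⟨⟨h22', h23'⟩, hS'⟩, h81'⟩ :=
    h D χ (le_trans (le_trans (le_max_left _ _) (le_max_left _ _)) hD) hq hp
  have h71D := h71' D χ (le_trans (le_trans (le_max_right _ _) (le_max_left _ _)) hD) hq hp hA
  -- the sequence and its conjugate
  set a : ℕ → ℂ := fun n =>
    if 1 ≤ n ∧ (n : ℝ) < Skeleton.P1 D then χ (n : ZMod D) * (n : ℂ) ^ (-(v * I)) else 0 with ha_def
  set b : ℕ → ℂ := fun n => conj (a n) with hb_def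
  have hadm : Adm72 D 1 a := adm72_twist χ hlog v
  have hbdm : Adm72 D 1 b := adm72_conj hadm
  have hba : (fun n => conj (b n)) = a := by funext n; simp [hb_def]
  -- pointwise facts at the zeros
  have mem : ∀ i ∈ idx χ, i.1 ∈ PsiOne χ ∧ i.2 ∈ zeroSet D i.1 := fun i hi => mem_idx χ hi
  have hre : ∀ i ∈ idx χ, i.2.re = 1 / 2 := fun i hi =>
    h22' i.1 (mem i hi).1 i.2 (mem_prodZeroSetOmega_of_mem_zeroSet χ (mem i hi).2)
  have hcIm : ∀ i ∈ idx χ, (cstar c' D i.1 i.2).im = 0 := fun i hi =>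
    (h23' i.1 (mem i hi).1 i.2 (mem i hi).2).1
  have hωIm : ∀ i ∈ idx χ, (omegaW D i.2).im = 0 := fun i hi => (omegaW_re_pos hD3 (hre i hi)).2
  -- Lemma 8.1 and Prop 7.1 at (a, b)
  have k81 := h81' hA a b hadm hbdm
  rw [hba] at k81
  have k71 := h71D a b hadm hbdm
  -- sizes of `S_j`, `E`, main term
  have hS1 := hS' 1 (by simp) a b hadm hbdm
  have hS2 := hS' 2 (by simp) a b hadm hbdm
  have hS3 := hS' 3 (by simp) a b hadm hbdm
  have hP : 0 ≤ frakP D := frakP_nonneg D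
  have hℓ0 : 0 < ell D := by linarith
  have hK : K * ell D ^ B ≤ |K| * ell D ^ B :=
    mul_le_mul_of_nonneg_right (le_abs_self K) (by positivity)
  have hα : alpha D = π / ell D ^ 9 := by rw [alpha, bigP, Real.log_exp]
  have hE : Ecal c' D a b ≤ 3 * |K| * ell D ^ (B + 2) * frakP D := by
    rw [Ecal]
    calc frakP D * ell D ^ 2 * (‖Sj c' D 1 a b‖ + ‖Sj c' D 2 a b‖ + ‖Sj c' D 3 a b‖)
        ≤ frakP D * ell D ^ 2 * (|K| * ell D ^ B + |K| * ell D ^ B + |K| * ell D ^ B) := by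
          gcongr <;> linarith
      _ = 3 * |K| * ell D ^ (B + 2) * frakP D := by ring
  have hmain : ‖mainMV c' D a b‖ ≤ (4 / π) * |K| * ell D ^ (B + 9) * frakP D := by
    rw [mainMV, hα, norm_mul, norm_mul, Complex.norm_real, Real.norm_of_nonneg hP, norm_inv,
      Complex.norm_real, Real.norm_of_nonneg (by positivity)]
    have hsum : ‖1 / 2 * Sj c' D 1 a b + 2 * Sj c' D 2 a b + 3 / 2 * Sj c' D 3 a b‖ ≤
        4 * (|K| * ell D ^ B) := by
      calc _ ≤ ‖1 / 2 * Sj c' D 1 a b‖ + ‖2 * Sj c' D 2 a b‖ + ‖3 / 2 * Sj c' D 3 a b‖ :=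
            norm_add₃_le
        _ = 1 / 2 * ‖Sj c' D 1 a b‖ + 2 * ‖Sj c' D 2 a b‖ + 3 / 2 * ‖Sj c' D 3 a b‖ := by
            rw [norm_mul, norm_mul, norm_mul]; norm_num
        _ ≤ 1 / 2 * (|K| * ell D ^ B) + 2 * (|K| * ell D ^ B) + 3 / 2 * (|K| * ell D ^ B) := by
            gcongr <;> linarith
        _ = 4 * (|K| * ell D ^ B) := by ring
    have hinv : (π / ell D ^ 9)⁻¹ = ell D ^ 9 / π := by rw [inv_div]
    rw [hinv]
    calc ell D ^ 9 / π * ‖1 / 2 * Sj c' D 1 a b + 2 * Sj c' D 2 a b + 3 / 2 * Sj c' D 3 a b‖ *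
          frakP D ≤ ell D ^ 9 / π * (4 * (|K| * ell D ^ B)) * frakP D := by gcongr
      _ = (4 / π) * |K| * ell D ^ (B + 9) * frakP D := by ring
  have hΘ : ‖Theta1 c' χ a b‖ ≤ ((4 / π) * |K| + 3 * |C| * |K| + 1) * ell D ^ (B + 9) * frakP D := by
    have h1 : ‖Theta1 c' χ a b‖ ≤ ‖mainMV c' D a b‖ + ‖Theta1 c' χ a b - mainMV c' D a b‖ :=
      norm_le_insert' _ _
    have h2 : C * Ecal c' D a b ≤ |C| * (3 * |K| * ell D ^ (B + 2) * frakP D) := by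
      have hE0 : 0 ≤ Ecal c' D a b := by rw [Ecal]; positivity
      exact le_trans (mul_le_mul_of_nonneg_right (le_abs_self C) hE0)
        (mul_le_mul_of_nonneg_left hE (abs_nonneg C))
    have h9 : 1 ≤ ell D ^ (B + 9) := one_le_pow₀ (by linarith)
    have h29 : ell D ^ (B + 2) ≤ ell D ^ (B + 9) := pow_le_pow_right₀ (by linarith) (by omega)
    nlinarith [mul_le_mul_of_nonneg_right h9 hP, mul_le_mul_of_nonneg_right h29 hP,
      abs_nonneg C, abs_nonneg K, mul_nonneg (mul_nonneg (abs_nonneg C) (abs_nonneg K)) hP]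
  -- the left side of Lemma 8.1 is the mean square
  have hlhs : lhs81 c' χ a b = ∑ i ∈ idx χ, cstar c' D i.1 i.2 *
      ((‖Apoly i.1 a i.2‖ ^ 2 : ℝ) : ℂ) * omegaW D i.2 := lhs81_conj_eq c' χ a hre
  have hre_sum : (lhs81 c' χ a b).re = ∑ i ∈ idx χ, (cstar c' D i.1 i.2).re *
      ‖∑ n ∈ Finset.Ico 1 ⌈Skeleton.P1 D⌉₊, pc χ i.1 n * (n : ℂ) ^ (-(i.2 + v * I))‖ ^ 2 *
      (omegaW D i.2).re := by
    rw [hlhs, Complex.re_sum]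
    refine Finset.sum_congr rfl fun i hi => ?_
    rw [Complex.mul_re, Complex.mul_re, Complex.mul_im, hcIm i hi, hωIm i hi, Complex.ofReal_re,
      Complex.ofReal_im, Apoly_twist χ i.1 hlog v i.2]
    ring
  have h9 : 1 ≤ ell D ^ (B + 9) := one_le_pow₀ (by linarith)
  calc ∑ i ∈ idx χ, (cstar c' D i.1 i.2).re *
          ‖∑ n ∈ Finset.Ico 1 ⌈Skeleton.P1 D⌉₊, pc χ i.1 n * (n : ℂ) ^ (-(i.2 + v * I))‖ ^ 2 *
          (omegaW D i.2).re
      = (lhs81 c' χ a b).re := hre_sum.symm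
    _ ≤ ‖lhs81 c' χ a b‖ := Complex.re_le_norm _
    _ ≤ ‖Theta1 c' χ a b + conj (Theta1 c' χ a b)‖ +
          ‖lhs81 c' χ a b - (Theta1 c' χ a b + conj (Theta1 c' χ a b))‖ := norm_le_insert' _ _
    _ ≤ (‖Theta1 c' χ a b‖ + ‖Theta1 c' χ a b‖) + 1 * frakP D := by
        refine add_le_add (le_trans (norm_add_le _ _) ?_) k81
        rw [RCLike.norm_conj]
    _ ≤ (2 * ((4 / π) * |K| + 3 * |C| * |K| + 1) + 1) * ell D ^ (B + 9) * frakP D := by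
        nlinarith [mul_le_mul_of_nonneg_right h9 hP]

/-! ### Step 2: the `E₂` mean square from the discrete mean value -/

omit [NeZero D] in
/-- Continuity in `v` of `v ↦ |Σ_{1≤n<N} χψ(n)n^{−(s+iv)}|`. [folklore-level bookkeeping for
§11 p. 65] [cite: Zhang2022LandauSiegel, §11 Lemma 11.2] -/
theorem continuous_norm_twistSum (N : ℕ) (s : ℂ) :
    Continuous fun v : ℝ => ‖∑ n ∈ Finset.Ico 1 N, pc χ x n * (n : ℂ) ^ (-(s + v * I))‖ := by
  refine Continuous.norm (continuous_finsetSum _ fun n hn => ?_)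
  have hn0 : (n : ℂ) ≠ 0 := by
    rw [Finset.mem_Ico] at hn; exact_mod_cast (by omega : n ≠ 0)
  refine continuous_const.mul (Continuous.const_cpow ?_ (Or.inl hn0))
  fun_prop

omit [NeZero D] in
/-- **`E₂(s,ψ)² ≤ 𝓛⁻¹³⁶·2𝓛²⁰·∫_{−𝓛²⁰}^{𝓛²⁰}|Σ_{n<P₁}χψ(n)n^{−(s+iv)}|²dv`** (Cauchy–Schwarz in
`v`; `0 < ω₁(iv) = e^{−v²/(4𝓛³⁰)} ≤ 1`), for `D ≥ 3`.
[cite: Zhang2022LandauSiegel, §11 Lemma 11.2, p. 65] -/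
theorem E2main_sq_le (hD : 3 ≤ D) (s : ℂ) :
    E2main χ x s ^ 2 ≤ ((ell D ^ 68)⁻¹) ^ 2 * (2 * ell D ^ 20) *
      ∫ v in (-(ell D ^ 20))..(ell D ^ 20),
        ‖∑ n ∈ Finset.Ico 1 ⌈Skeleton.P1 D⌉₊, pc χ x n * (n : ℂ) ^ (-(s + v * I))‖ ^ 2 := by
  have hℓ : 1 < ell D := one_lt_ell hD
  rw [E2main, mul_pow]
  set L : ℝ := ell D ^ 20 with hL
  have hL0 : 0 ≤ L := by positivity
  have hLL : -L ≤ L := by linarith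
  set f : ℝ → ℝ := fun v => ‖∑ n ∈ Finset.Ico 1 ⌈Skeleton.P1 D⌉₊, pc χ x n * (n : ℂ) ^ (-(s + v * I))‖
    with hf
  have hfc : Continuous f := continuous_norm_twistSum χ x _ s
  have hwc : Continuous fun v : ℝ => Real.exp (-(v ^ 2) / (4 * ell D ^ 30)) := by fun_prop
  -- drop the Gaussian weight
  have hI : ∫ v in (-L)..L, f v * Real.exp (-(v ^ 2) / (4 * ell D ^ 30)) ≤ ∫ v in (-L)..L, f v := by
    refine intervalIntegral.integral_mono_on hLL ((hfc.mul hwc).intervalIntegrable _ _)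
      (hfc.intervalIntegrable _ _) fun v _ => ?_
    have hf0 : 0 ≤ f v := norm_nonneg _
    have hw1 : Real.exp (-(v ^ 2) / (4 * ell D ^ 30)) ≤ 1 := by
      rw [Real.exp_le_one_iff, neg_div]; exact neg_nonpos.mpr (by positivity)
    exact mul_le_of_le_one_right hf0 hw1
  have hI0 : 0 ≤ ∫ v in (-L)..L, f v * Real.exp (-(v ^ 2) / (4 * ell D ^ 30)) :=
    intervalIntegral.integral_nonneg hLL fun v _ => mul_nonneg (norm_nonneg _) (Real.exp_pos _).le
  have hsq := sq_integral_le hLL hfc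
  have h2 : (∫ v in (-L)..L, f v * Real.exp (-(v ^ 2) / (4 * ell D ^ 30))) ^ 2 ≤
      (2 * L) * ∫ v in (-L)..L, f v ^ 2 := by
    calc _ ≤ (∫ v in (-L)..L, f v) ^ 2 := pow_le_pow_left₀ hI0 hI 2
      _ ≤ (L - -L) * ∫ v in (-L)..L, f v ^ 2 := hsq
      _ = (2 * L) * ∫ v in (-L)..L, f v ^ 2 := by ring
  calc ((ell D ^ 68)⁻¹) ^ 2 * (∫ v in (-L)..L, f v * Real.exp (-(v ^ 2) / (4 * ell D ^ 30))) ^ 2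
      ≤ ((ell D ^ 68)⁻¹) ^ 2 * ((2 * L) * ∫ v in (-L)..L, f v ^ 2) :=
        mul_le_mul_of_nonneg_left h2 (by positivity)
    _ = ((ell D ^ 68)⁻¹) ^ 2 * (2 * ell D ^ 20) * ∫ v in (-L)..L, f v ^ 2 := by rw [hL]; ring

/-- **`Step11u027` from a discrete mean-value bound** with exponent `A ≤ 95`: if, under (A) and for
`D` large, `ΣΣ𝔠*(ρ,ψ)|Σ_{n<P₁}χψ(n)n^{−(ρ+iv)}|²ω(ρ) ≤ K𝓛^A𝔓` for all real `v`, then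
`ΣΣ𝔠*E₂(ρ,ψ)²ω(ρ) = o(𝔞𝔓)` (indeed `≤ 4K𝓛^{A−96}𝔓`, and `𝔞 ≫ 1`).
[cite: Zhang2022LandauSiegel, §11 p. 65, tex L3348–L3352] -/
theorem step11u027_of_dmv {A : ℕ} (hA : A ≤ 95) (h23 : Lemma23 c') (h22 : Prop22i)
    (ha : FrakALowerBound)
    (hdmv : ∃ K : ℝ, ForAllLarge fun D _ χ => AssumptionA D χ → ∀ v : ℝ,
      ∑ i ∈ idx χ, (cstar c' D i.1 i.2).re *
          ‖∑ n ∈ Finset.Ico 1 ⌈Skeleton.P1 D⌉₊, pc χ i.1 n * (n : ℂ) ^ (-(i.2 + v * I))‖ ^ 2 *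
          (omegaW D i.2).re ≤ K * ell D ^ A * frakP D) :
    Step11u027 c' := by
  intro ε hε
  obtain ⟨K, hdmv⟩ := hdmv
  obtain ⟨a₀, ha₀, ha⟩ := ha
  obtain ⟨D₀, h⟩ := ((h22.and h23).and hdmv).and ha
  -- threshold: `4(|K|+1)/𝓛 ≤ ε a₀`
  set M : ℝ := 4 * (|K| + 1) / (ε * a₀) with hM
  have hM0 : 0 < M := by positivity
  set D₁ : ℕ := ⌈Real.exp M⌉₊ with hD₁
  refine ⟨max (max D₀ D₁) 8, fun D _ χ hD hq hp hA' => ?_⟩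
  have hD8 : 8 ≤ D := le_trans (le_max_right _ _) hD
  have hD3 : 3 ≤ D := le_trans (by norm_num) hD8
  have hlog := two_le_log_of_eight_le hD8
  have hℓ : 2 ≤ ell D := by rw [ell]; exact hlog
  have hDD₁ : D₁ ≤ D := le_trans (le_trans (le_max_right _ _) (le_max_left _ _)) hD
  obtain ⟨⟨⟨h22', h23'⟩, hdmv'⟩, ha'⟩ :=
    h D χ (le_trans (le_trans (le_max_left _ _) (le_max_left _ _)) hD) hq hp
  have mem : ∀ i ∈ idx χ, i.1 ∈ PsiOne χ ∧ i.2 ∈ zeroSet D i.1 := fun i hi => mem_idx χ hi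
  have hre : ∀ i ∈ idx χ, i.2.re = 1 / 2 := fun i hi =>
    h22' i.1 (mem i hi).1 i.2 (mem_prodZeroSetOmega_of_mem_zeroSet χ (mem i hi).2)
  have hc0 : ∀ i ∈ idx χ, 0 ≤ (cstar c' D i.1 i.2).re := fun i hi =>
    (h23' i.1 (mem i hi).1 i.2 (mem i hi).2).2
  have hω : ∀ i ∈ idx χ, 0 < (omegaW D i.2).re := fun i hi => (omegaW_re_pos hD3 (hre i hi)).1
  have hP : 0 ≤ frakP D := frakP_nonneg D
  have hℓ0 : 0 < ell D := by linarith
  set L : ℝ := ell D ^ 20 with hL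
  have hL0' : 0 ≤ L := by positivity
  have hLL : -L ≤ L := by linarith
  -- abbreviations
  set F : ((_ : Chr D) × ℂ) → ℝ → ℝ := fun i v =>
    ‖∑ n ∈ Finset.Ico 1 ⌈Skeleton.P1 D⌉₊, pc χ i.1 n * (n : ℂ) ^ (-(i.2 + v * I))‖ with hFdef
  set G : ℝ → ℝ := fun v =>
    ∑ i ∈ idx χ, (cstar c' D i.1 i.2).re * F i v ^ 2 * (omegaW D i.2).re with hGdef
  have hFc : ∀ i, Continuous (F i) := fun i => continuous_norm_twistSum χ i.1 _ i.2
  have hGbound : ∀ v : ℝ, G v ≤ K * ell D ^ A * frakP D := fun v => hdmv' hA' v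
  have hG0 : ∀ v : ℝ, 0 ≤ G v := fun v =>
    Finset.sum_nonneg fun i hi => mul_nonneg (mul_nonneg (hc0 i hi) (sq_nonneg _)) (hω i hi).le
  -- the v-integral of G
  have hintG : ∫ v in (-L)..L, G v ≤ K * ell D ^ A * frakP D * (2 * L) := by
    have hb : ∀ v ∈ Set.uIoc (-L) L, ‖G v‖ ≤ K * ell D ^ A * frakP D := fun v _ => by
      rw [Real.norm_of_nonneg (hG0 v)]; exact hGbound v
    have := intervalIntegral.norm_integral_le_of_norm_le_const hb
    rw [show |L - -L| = 2 * L by rw [abs_of_nonneg (by linarith)]; ring] at this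
    exact le_trans (Real.le_norm_self _) this
  -- termwise: `𝔠* E₂² ω ≤ ℓ⁻¹³⁶·2L·𝔠*(∫F²)ω`
  have hterm : ∀ i ∈ idx χ,
      (cstar c' D i.1 i.2).re * E2main χ i.1 i.2 ^ 2 * (omegaW D i.2).re ≤
        ((ell D ^ 68)⁻¹) ^ 2 * (2 * L) *
          ((cstar c' D i.1 i.2).re * (∫ v in (-L)..L, F i v ^ 2) * (omegaW D i.2).re) := by
    intro i hi
    have h1 := E2main_sq_le χ i.1 hD3 i.2
    have h2 := mul_le_mul_of_nonneg_right (mul_le_mul_of_nonneg_left h1 (hc0 i hi)) (hω i hi).le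
    calc _ ≤ (cstar c' D i.1 i.2).re * (((ell D ^ 68)⁻¹) ^ 2 * (2 * ell D ^ 20) *
          ∫ v in (-L)..L, F i v ^ 2) * (omegaW D i.2).re := h2
      _ = _ := by rw [hL]; ring
  -- interchange of the finite sum and the v-integral
  have hswap : ∑ i ∈ idx χ, (cstar c' D i.1 i.2).re * (∫ v in (-L)..L, F i v ^ 2) *
      (omegaW D i.2).re = ∫ v in (-L)..L, G v := by
    rw [hGdef, intervalIntegral.integral_finsetSum]
    · refine Finset.sum_congr rfl fun i _ => ?_
      rw [← intervalIntegral.integral_const_mul, ← intervalIntegral.integral_mul_const]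
    · intro i _
      exact ((continuous_const.mul ((hFc i).pow 2)).mul continuous_const).intervalIntegrable _ _
  -- the size of the constant
  have hsmall : ((ell D ^ 68)⁻¹) ^ 2 * (2 * L) * (K * ell D ^ A * frakP D * (2 * L)) ≤
      ε * a₀ * frakP D := by
    have hM1 : M ≤ ell D := by
      have hexp : Real.exp M ≤ D := le_trans (Nat.le_ceil _) (by exact_mod_cast hDD₁)
      have := Real.log_le_log (Real.exp_pos _) hexp
      rwa [Real.log_exp, ← ell] at this
    have hK : K * ell D ^ A ≤ (|K| + 1) * ell D ^ 95 := by
      have h1 : ell D ^ A ≤ ell D ^ 95 := pow_le_pow_right₀ (by linarith) hA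
      nlinarith [le_abs_self K, abs_nonneg K, pow_nonneg hℓ0.le A, h1]
    have e1 : ((ell D ^ 68)⁻¹) ^ 2 * (2 * L) * (K * ell D ^ A * frakP D * (2 * L)) =
        4 * (K * ell D ^ A) * frakP D / ell D ^ 96 := by
      rw [hL]; field_simp; ring
    rw [e1, div_le_iff₀ (by positivity)]
    have e2 : ell D ^ 96 = ell D ^ 95 * ell D := by ring
    have hεa : 4 * (|K| + 1) ≤ ε * a₀ * ell D := by
      have := (div_le_iff₀ (by positivity : 0 < ε * a₀)).mp hM1
      linarith
    calc 4 * (K * ell D ^ A) * frakP D ≤ 4 * ((|K| + 1) * ell D ^ 95) * frakP D := by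
          gcongr
      _ = (4 * (|K| + 1)) * ell D ^ 95 * frakP D := by ring
      _ ≤ (ε * a₀ * ell D) * ell D ^ 95 * frakP D := by gcongr
      _ = ε * a₀ * frakP D * ell D ^ 96 := by rw [e2]; ring
  have haA : a₀ ≤ frakA χ := ha' hA'
  calc ∑ i ∈ idx χ, (cstar c' D i.1 i.2).re * E2main χ i.1 i.2 ^ 2 * (omegaW D i.2).re
      ≤ ∑ i ∈ idx χ, ((ell D ^ 68)⁻¹) ^ 2 * (2 * L) *
          ((cstar c' D i.1 i.2).re * (∫ v in (-L)..L, F i v ^ 2) * (omegaW D i.2).re) :=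
        Finset.sum_le_sum hterm
    _ = ((ell D ^ 68)⁻¹) ^ 2 * (2 * L) * ∫ v in (-L)..L, G v := by
        rw [← Finset.mul_sum, hswap]
    _ ≤ ((ell D ^ 68)⁻¹) ^ 2 * (2 * L) * (K * ell D ^ A * frakP D * (2 * L)) :=
        mul_le_mul_of_nonneg_left hintG (by positivity)
    _ ≤ ε * a₀ * frakP D := hsmall
    _ ≤ ε * frakA χ * frakP D := by gcongr

/-- **`Z22:§11.u027` reduced to `S_j ≪ 𝓛^B`**: Lemma 2.3, Prop. 2.2 (i), Lemma 8.1, Prop. 7.1,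
`𝔞 ≫ 1` and a bound `|S_j(𝐚₁,𝐚₂)| ≤ K𝓛^B` (`B ≤ 86`) for all sequences admissible for (7.2) with
`|a(n)| ≤ 1` imply `ΣΣ𝔠*E₂(ρ,ψ)²ω(ρ) = o(𝔞𝔓)` — the reading of "by (8.25), (8.26) and simple
estimates". [cite: Zhang2022LandauSiegel, §11 p. 65, tex L3348–L3352] -/
theorem step11u027_of_sjPolylog {B : ℕ} (hB : B ≤ 86) (h23 : Lemma23 c') (h22 : Prop22i)
    (h81 : Lemma81 c') (h71 : Prop71 c') (ha : FrakALowerBound)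
    (hS : ∃ K : ℝ, ForAllLarge fun D _ _ => ∀ j ∈ ({1, 2, 3} : Finset ℕ), ∀ a₁ a₂ : ℕ → ℂ,
      Adm72 D 1 a₁ → Adm72 D 1 a₂ → ‖Sj c' D j a₁ a₂‖ ≤ K * ell D ^ B) :
    Step11u027 c' :=
  step11u027_of_dmv c' (A := B + 9) (by omega) h23 h22 ha
    (dmv_of_lemma81_prop71 c' h23 h22 h81 h71 hS)

end Main

end Literature.NumberTheory.LFunctions.Zhang2022.Section11E2MeanSquare
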